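import Literature.NumberTheory.Automorphic.GL2ArchParameterOfEigenform
import Summits.Langlands.Langlands.Theorems.PhantomRMYoshidaSerreKWAutomorphicGL2AdelicLiftIsCuspForm
import HarnessLib

/-!
# Stub `stub_archParameterOfGeneratedDatum` of line `adelic-newform-datum-double-twist`
# (crux stmt-Langlands-12944 `PhantomRMYoshida.SerreKWAutomorphicGL2`, lead-held stub)

The archimedean half of the classical → adelic dictionary for the Khare–Wintenberger newform: for
any cusp form `f ∈ S_w(Γ₁(N))` whose adelic lift `φ_f = adelicLiftFunA N w f` is killed by the
lowering operator along `ι_𝔸` and lies in `𝒜₀(GL₂(𝔸_ℚ))`, the cuspidal automorphic representation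
datum GENERATED by `φ_f` has Harish-Chandra parameter `{(w-1)/2, (1-w)/2}`. The Casimir
eigen-equation is first order (`X̄X = 2Ω + W² - 2iW`, `X φ_f = 0`, `W φ_f = iw φ_f`, `Z φ_f = 0`;
`sum_lieDeriv_single_adelicLiftFunA_of_lowerFun_eq_zero` of the sibling stub file
`…AdelicLiftIsCuspForm`); the parameter is read off by the cyclicity dictionary step
`CuspidalAutomorphicRepData.hasArchParameter_ofCuspForm_of_casimir_of_zed` of
`Literature.NumberTheory.Automorphic.GL2ArchParameterOfEigenform` (landed for this stub, with
`CuspidalRepDataOfCuspFormInfChar`: infinitesimal character of the generated datum by minimality of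
the stable closure, then Harish-Chandra for `𝔤𝔩₂(ℝ)` at the unique real place of `ℚ`).
Registered signature verbatim (skeleton `Cruxes/SerreKWAutomorphicGL2/Lines/adelic-newform-datum-double-twist.lean`).
-/

noncomputable section

-- (H5) the place subtypes indexing the factors of `mixedSpace ℚ` use classical `Fintype` instances, as in `AdelicGLnGlue`.
open scoped MatrixGroups Matrix Classical
open Literature.NumberTheory.Automorphic NumberField CongruenceSubgroup

namespace Summit.Langlands.Langlands.Cruxes.SerreKWAutomorphicGL2.AdelicNewformDatumDoubleTwist

set_option linter.dupNamespace false

open GL2Real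

/-- **Stub 6 (`stub_archParameterOfGeneratedDatum`, registered signature verbatim): the
archimedean parameter of the cuspidal datum generated by the adelic lift of a cusp form.**  For ANY
cusp form `f ∈ S_w(Γ₁(N))` (any weight) whose adelic lift `φ_f = adelicLiftFunA N w f` is killed by
the lowering operator along `ι_𝔸` and lies in `𝒜₀(GL₂)`, non-zero, the datum
`CuspidalAutomorphicRepData.ofCuspForm hφ hφ0` GENERATED by `φ_f` has archimedean (Harish-Chandra)
parameter `{(w-1)/2, (1-w)/2}` — the infinitesimal character of the weight-`w` discrete series.
Proof: `φ_f` is arch-smooth (`automorphicForms_le_archSmooth`), the Casimir eigen-equation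
`∑ E_{ab}E_{ba} φ_f = (s₁² + s₂² - ½) φ_f` (`sum_lieDeriv_single_adelicLiftFunA_of_lowerFun_eq_zero`)
and `Z φ_f = 0 = (s₁ + s₂) φ_f` (`lieDeriv_one_adelicLiftFunA`) feed
`CuspidalAutomorphicRepData.hasArchParameter_ofCuspForm_of_casimir_of_zed`. Gelbart 1975, Thm. 5.19;
Bump 1997, Thm. 2.7.1; Langlands 1979, proof of Prop. 2; Knapp 2002, Thm. 5.44.
[cite: Gelbart1975, Thm. 5.19] [cite: LanglandsCorvallis1979Notion, proof of Prop. 2]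
[cite: Knapp2002, §V.5 Thm. 5.44 and Prop. 5.32] -/
theorem stub_archParameterOfGeneratedDatum :
    ∀ (N : ℕ) [NeZero N] (w : ℤ) (f : CuspForm (Gamma1 N) w)
      (hcpt : isCompact_glFiniteIntegralLevel 2 ℚ),
      GL2Real.lowerFun Rat.iotaA (adelicLiftFunA N w ⇑f) = 0 →
      ∀ (hφ : adelicLiftFunA N w ⇑f ∈ cuspFormsGL 2 ℚ hcpt) (hφ0 : adelicLiftFunA N w ⇑f ≠ 0),
      (CuspidalAutomorphicRepData.ofCuspForm hφ hφ0).1.HasArchParameter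
        (fun _ => ({((w : ℂ) - 1) / 2, (1 - (w : ℂ)) / 2} : Multiset ℂ)) := by
  intro N _ w f hcpt hlow hφ hφ0
  have hsm : IsArchSmooth (AutomorphyDatum.gl 2 ℚ hcpt).ofArch (adelicLiftFunA N w ⇑f) :=
    automorphicForms_le_archSmooth _ (cuspFormsGL_le_automorphicForms 2 ℚ hcpt hφ)
  have hC := sum_lieDeriv_single_adelicLiftFunA_of_lowerFun_eq_zero f hsm hlow
  have hZ : lieDeriv Rat.iotaA (toLie 1) (adelicLiftFunA N w ⇑f) =
      (((w : ℂ) - 1) / 2 + (1 - (w : ℂ)) / 2) • adelicLiftFunA N w ⇑f := by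
    rw [show ((w : ℂ) - 1) / 2 + (1 - (w : ℂ)) / 2 = 0 by ring, zero_smul]
    exact lieDeriv_one_adelicLiftFunA f
  exact CuspidalAutomorphicRepData.hasArchParameter_ofCuspForm_of_casimir_of_zed hφ hφ0 hC hZ

end Summit.Langlands.Langlands.Cruxes.SerreKWAutomorphicGL2.AdelicNewformDatumDoubleTwist

end
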